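import Summits.BirchSwinnertonDyer.BirchSwinnertonDyer.Theorems.QuadraticBranchSignedControlPlusEtaNonsurjThetaFunctionalEquationExact
import Summits.BirchSwinnertonDyer.BirchSwinnertonDyer.Theorems.QuadraticBranchSignedControlPlusEtaNonsurjThetaFunctionalEquationRootNumber
import HarnessLib

/-!
# Route `QuadraticBranchSignedControl` (rung K8, cell `bsd-potss`), residual crux `PlusEtaMainConjectureNonsurj`
# (stmt-BirchSwinnertonDyer-19606): THE FUNCTIONAL EQUATION ON THE QUADRATIC BRANCH, X — THE EXACT EQUATION OF EVERY `L_p^±(V, η, X)`: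
# `ι L = w·(1+T)^{c+b}·L` (plus), `ι L = w·(1+T)^{c+a}·L` (minus), ANY period ratio; the shape of `Sprung2017.cor414_…`; IDEAL FORM
# `(ι L) = (L)`; row and conductor-level currency `w = w_V·(−N_V | p)` (seat `bsd-potss-k8eta-c2` g28; kernel, class-wide)

WHY. Part IX (`…ThetaFunctionalEquationExact`) proved the exact `Λ`-adic functional equations of the Mazur–Tate limits `M^±` of the
quadratic branch with `p`-adic exponents `c + b` / `c + a` (`(p+1)b = −1`, `(p+1)a = −p`, `c` the `p`-adic exponent of `N`) and sign
`w = σ·(−N | p)`. THIS FILE puts them on the objects every record of the crux is about — the tree's branch functions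
`IsQuadraticBranch{Plus,Minus}LFunction f p ϖ L` (Kobayashi's `L_p^±(V, η, X)` up to `ℤ_pˣ`) — and in the consumers' currencies:
(§22) **`ι L = w·(1+T)^{c+b}·L` for EVERY plus branch function and `ι L = w·(1+T)^{c+a}·L` for every minus one, for ANY period ratio
`ϖ ∈ ℚ`** (no `p`-integrality: `p^k·L` is a constant multiple of `M^±` by x1b's uniqueness, constants commute with `ι`, cancel `p^k` in
the domain `Λ`), hence no Manin-constant / Mazur fact anywhere in this file; the existence forms (`∃ e, ι L = w(1+T)^e L`); the equations
in the SHAPE OF THE TREE'S NAMED FACT `Sprung2017.cor414_sharpFlat_functionalEquation_apZero` (any `ι ∈ Λ` with `(1+T)(ι+1) = 1`,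
`L.subst ι = s·(1+T)^{c+b}·L`; that fact — the TRIVIAL branch — is itself a tree theorem, `…_holds`, by transport + uniqueness of the Sprung
pair; ERRATUM (g28, same day, docstring only): the first landed text of this file said it "stays a named fact") — the η-branch twin; the IDEAL FORM **`Ideal.span {ι L} = Ideal.span {L}`** and
`Associated (ι L) L` with NO sign / exponent / period hypothesis (the sign `±1` and `(1+T)^e` are units; Greenberg: "`f(T^ι)/f(T)` should
be in `Λ^×`") — so the analytic side `(L_p⁺(V,η,X))` of the η-main conjecture of the crux is insensitive to the `γ ↦ γ⁻¹` convention
on the Selmer side; (§23) the crux's ROW currency (`V` good at `p ≥ 5`, `a_p(V) = 0`, newform `f` of any level, hypothesis-free beyond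
the row data) and the CONDUCTOR level, where the Fricke sign is the root number (Part VII): the sign is `w_V·(−N_V | p) = w(V ⊗ η)`.

WHAT. §22 `exists_natCast_add_one_mul_eq` (`p + 1 ∈ ℤ_pˣ`: Part IX's `norm_natCast_add_one`; cf. `LargeImageParityStratum.isUnit_natCast_add_one`), `exists_norm_pow_mul_le_one`, `isUnit_C_sign_mul_binomialSeries`,
**`invol_eq_of_isQuadraticBranch{Plus,Minus}LFunction`**, `exists_invol_eq_of_isQuadraticBranch{Plus,Minus}LFunction`,
`eq_invSubOne_of_one_add_X_mul_eq_one`, `subst_eq_of_isQuadraticBranch{Plus,Minus}LFunction` (named-fact shape),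
**`span_invol_eq_of_isQuadraticBranch{Plus,Minus}LFunction`**, `associated_invol_of_isQuadraticBranch{Plus,Minus}LFunction`;
§23 `invol_eq_{plus,minus}_row`, `span_invol_eq_{plus,minus}_row`, `invol_eq_{plus,minus}_rootNumber`.

HONEST FRAMING (cell `bsd-potss`; FULL-BSD rank ≤ 1 programme, HUMAN RULING D-0036/D-0074): TOOL THEOREMS ONLY — no definition, no
named fact, no `sorry`, axioms standard; nothing about (A), (C1⁺_η), C-cc-1 or `BSD(W,p)` of any pair is claimed; no stub of 19606 is
proved; crux and route OPEN; nothing booked. Not here: the trivial branch (the tree theorem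
`Sprung2017.cor414_sharpFlat_functionalEquation_apZero_holds`). `--supports stmt-BirchSwinnertonDyer-19606`.

References: [Sprung2017] Cor. 4.14 (`a_p = 0` display, `ωⁱ(−N)`) and §3.5; [Pollack2003] Thm. 5.13; [MazurTateTeitelbaum1986Invent] §I.17;
[GreenbergLNM1716] §1 (pp. 67–68) and Thm. 1.14; [Kobayashi2003] Thm. 3.2, (3.4)–(3.5); [AtkinLehner1970] Thm. 3. Tree: Parts I–IX,
`Additive/QuadraticBranch{Plus,Minus}LFunction{Existence,Unique}.lean` (x1b), `Sprung2017/SharpFlatFunctionalEquation.lean` (the shape mirrored).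
-/

set_option autoImplicit false
set_option linter.dupNamespace false
noncomputable section

open scoped Classical MatrixGroups ModularForm Topology

open Filter CongruenceSubgroup Polynomial WeierstrassCurve Literature.NumberTheory.EllipticCurves
  Literature.NumberTheory.EllipticCurves.ModularForms
open Literature.NumberTheory.EllipticCurves.IwasawaAlgebra
open Summit.BirchSwinnertonDyer.Rank1Residual.Additive

namespace Summit.BirchSwinnertonDyer.BirchSwinnertonDyer.Theorems.EtaThetaFunctionalEquation

variable {p : ℕ} [hp : Fact p.Prime]

/-! ## §22 (continued) THE EXACT FUNCTIONAL EQUATION OF EVERY `L_p^±(V, η, X)`, packaged forms, ideal form -/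

/-- Division by `p + 1` in `ℤ_p` (`‖p+1‖ = 1`, Part IX): every `y` is `(p+1)·b` — so the exponent shifts `a = −p/(p+1)`, `b = −1/(p+1)` exist in
`ℤ_p`. [folklore] -/
theorem exists_natCast_add_one_mul_eq (y : ℤ_[p]) : ∃ b : ℤ_[p], ((p : ℤ_[p]) + 1) * b = y :=
  ⟨↑(PadicInt.isUnit_iff.mpr (norm_natCast_add_one (p := p))).unit⁻¹ * y, by rw [← mul_assoc, IsUnit.mul_val_inv, one_mul]⟩

/-- Every rational period ratio becomes `p`-integral after scaling by a power of `p`: `‖p^k ϖ‖_p ≤ 1` for some `k`. [folklore] -/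
theorem exists_norm_pow_mul_le_one (ϖ : ℚ) : ∃ k : ℕ, ‖(((p : ℚ) ^ k * ϖ : ℚ) : ℚ_[p])‖ ≤ 1 := by
  have hP : p.Prime := hp.out
  by_cases h0 : (ϖ : ℚ_[p]) = 0
  · exact ⟨0, by rw [pow_zero, one_mul, h0, norm_zero]; exact zero_le_one⟩
  have hpos : 0 < ‖(ϖ : ℚ_[p])‖ := norm_pos_iff.mpr h0
  obtain ⟨k, hk⟩ := PadicInt.exists_pow_neg_lt p (inv_pos.mpr hpos)
  refine ⟨k, ?_⟩
  rw [Rat.cast_mul, Rat.cast_pow, Rat.cast_natCast, norm_mul, norm_pow, Padic.norm_p, ← zpow_natCast, inv_zpow']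
  have h1 := mul_lt_mul_of_pos_right hk hpos
  rw [inv_mul_cancel₀ hpos.ne'] at h1
  exact h1.le

/-- `w·(1+T)^e` is a unit of `Λ` for a sign `w` (`w = 1 ∨ w = −1`) and any `p`-adic exponent `e` (constant term `w`).
[cite: GreenbergLNM1716, §1 (p. 68: "`f(T^ι)/f(T)` should be in `Λ^×`")] -/
theorem isUnit_C_sign_mul_binomialSeries {w : ℤ} (hw : w = 1 ∨ w = -1) (e : ℤ_[p]) :
    IsUnit (PowerSeries.C ((w : ℤ) : ℤ_[p]) * PowerSeries.binomialSeries ℤ_[p] e) := by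
  refine IsUnit.mul ?_ ?_
  · refine isUnit_iff_exists_inv.mpr ⟨PowerSeries.C ((w : ℤ) : ℤ_[p]), ?_⟩
    rw [← map_mul, ← Int.cast_mul]
    rcases hw with rfl | rfl <;> simp
  · rw [PowerSeries.isUnit_iff_constantCoeff, PowerSeries.binomialSeries_constantCoeff]
    exact isUnit_one

section Exact

variable {N : ℕ} [NeZero N] {f : CuspForm (Gamma0 N) 2}

/-- **THE EXACT FUNCTIONAL EQUATION OF EVERY PLUS BRANCH FUNCTION `L = L_p⁺(V, η, X)`** (`IsQuadraticBranchPlusLFunction f p ϖ L`,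
ANY period ratio `ϖ ∈ ℚ` — no `p`-integrality needed: scale by `p^k` and cancel in the domain `Λ`): `ι L = w · (1+T)^{c+b} · L` in `Λ`,
`w = σ·(−N | p)`, `(p+1)b = −1` — `p^k L` is a constant multiple of `M⁺` (x1b's uniqueness) and constants commute with `ι`. No hypothesis on
`μ`, on the image of `ρ_{V,p}`, on CM or on the rank.
[cite: Sprung2017, Cor. 4.14 (a_p = 0 display, ωⁱ(−N) sign)] [cite: Kobayashi2003, Thm. 3.2, (3.4)] [cite: MazurTateTeitelbaum1986Invent, §I.17] -/
theorem invol_eq_of_isQuadraticBranchPlusLFunction (hp2 : p ≠ 2) (hf0 : IsNewform0 f) (hQ : coeffField f = ⊥)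
    (hpN : ¬ p ∣ N) (hap : cuspCoeff f p = ((0 : ℤ) : ℂ)) {σ : ℤ} (hσ : σ ^ 2 = 1)
    (hW : atkinLehnerInvolution N 2 N f = (-(σ : ℂ)) • f)
    {ηN : rootsOfUnity (torsionOrder p) ℤ_[p]} {c : ℤ_[p]}
    (hc : ∀ n : ℕ, PadicInt.toZModPow (n + cyclotomicExponent p) ((ηN : ℤ_[p]ˣ) : ℤ_[p]) *
      (cyclotomicGenerator p : ZMod (p ^ (n + cyclotomicExponent p))) ^ (PadicInt.toZModPow n c).val =
        (N : ZMod (p ^ (n + cyclotomicExponent p))))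
    {b : ℤ_[p]} (hb : ((p : ℤ_[p]) + 1) * b = -1)
    {ϖ : ℚ} {L : IwasawaAlgebra p} (hL : IsQuadraticBranchPlusLFunction f p ϖ L) :
    invol p L = PowerSeries.C ((σ * legendreSym p (-(N : ℤ)) : ℤ) : ℤ_[p]) *
      PowerSeries.binomialSeries ℤ_[p] (c + b) * L := by
  have hP : p.Prime := hp.out
  obtain ⟨M, hM⟩ := exists_isCongrModOmega_quadraticBranch_even hp2 hf0 hQ hpN hap
  have h1 : IsQuadraticBranchPlusLFunction f p 1 M :=
    EtaPlusCoeffCongruence.isQuadraticBranchPlusLFunction_one_of_isCongrModOmega_even hp2 hM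
  obtain ⟨k, hk⟩ := exists_norm_pow_mul_le_one (p := p) ϖ
  set c' : ℤ_[p] := ⟨(((p : ℚ) ^ k * ϖ : ℚ) : ℚ_[p]), hk⟩ with hc'
  have h2 : IsQuadraticBranchPlusLFunction f p ((p : ℚ) ^ k * ϖ) (PowerSeries.C c' * M) := by
    have h := EtaPlusCoeffCongruence.isQuadraticBranchPlusLFunction_C_mul h1 c' ((p : ℚ) ^ k * ϖ) rfl
    rwa [mul_one] at h
  have h3 : IsQuadraticBranchPlusLFunction f p ((p : ℚ) ^ k * ϖ) (PowerSeries.C ((p : ℤ_[p]) ^ k) * L) :=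
    EtaPlusCoeffCongruence.isQuadraticBranchPlusLFunction_C_mul hL ((p : ℤ_[p]) ^ k) ((p : ℚ) ^ k) (by push_cast; rfl)
  obtain ⟨v, hv⟩ := IsQuadraticBranchPlusLFunction.exists_units_smul_eq hp2 h2 h3
  rw [PowerSeries.smul_eq_C_mul] at hv
  have hFE := invol_mazurTatePlus_eq hp2 hf0 hQ hpN hap hσ hW hc hb hM
  have hpk : PowerSeries.C ((p : ℤ_[p]) ^ k) ≠ 0 := fun h ↦ pow_ne_zero k (Nat.cast_ne_zero.mpr hP.ne_zero : (p : ℤ_[p]) ≠ 0)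
    (by simpa only [PowerSeries.constantCoeff_C, map_zero] using congr_arg PowerSeries.constantCoeff h)
  refine mul_left_cancel₀ hpk ?_
  have e1 : PowerSeries.C ((p : ℤ_[p]) ^ k) * invol p L = invol p (PowerSeries.C ((p : ℤ_[p]) ^ k) * L) := by
    rw [map_mul (invol p), invol_C]
  rw [e1, hv, map_mul (invol p), map_mul (invol p), invol_C, invol_C, hFE]
  linear_combination (-(PowerSeries.C ((σ * legendreSym p (-(N : ℤ)) : ℤ) : ℤ_[p]) *
    PowerSeries.binomialSeries ℤ_[p] (c + b))) * hv

/-- **THE EXACT FUNCTIONAL EQUATION OF EVERY MINUS BRANCH FUNCTION `L = L_p⁻(V, η, X)`** (any period ratio `ϖ`):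
`ι L = w · (1+T)^{c+a} · L`, `(p+1)a = −p`.
[cite: Sprung2017, Cor. 4.14 (a_p = 0 display, ωⁱ(−N) sign)] [cite: Kobayashi2003, Thm. 3.2, (3.5)] [cite: MazurTateTeitelbaum1986Invent, §I.17] -/
theorem invol_eq_of_isQuadraticBranchMinusLFunction (hp2 : p ≠ 2) (hf0 : IsNewform0 f) (hQ : coeffField f = ⊥)
    (hpN : ¬ p ∣ N) (hap : cuspCoeff f p = ((0 : ℤ) : ℂ)) {σ : ℤ} (hσ : σ ^ 2 = 1)
    (hW : atkinLehnerInvolution N 2 N f = (-(σ : ℂ)) • f)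
    {ηN : rootsOfUnity (torsionOrder p) ℤ_[p]} {c : ℤ_[p]}
    (hc : ∀ n : ℕ, PadicInt.toZModPow (n + cyclotomicExponent p) ((ηN : ℤ_[p]ˣ) : ℤ_[p]) *
      (cyclotomicGenerator p : ZMod (p ^ (n + cyclotomicExponent p))) ^ (PadicInt.toZModPow n c).val =
        (N : ZMod (p ^ (n + cyclotomicExponent p))))
    {a : ℤ_[p]} (ha : ((p : ℤ_[p]) + 1) * a = -(p : ℤ_[p]))
    {ϖ : ℚ} {L : IwasawaAlgebra p} (hL : IsQuadraticBranchMinusLFunction f p ϖ L) :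
    invol p L = PowerSeries.C ((σ * legendreSym p (-(N : ℤ)) : ℤ) : ℤ_[p]) *
      PowerSeries.binomialSeries ℤ_[p] (c + a) * L := by
  have hP : p.Prime := hp.out
  obtain ⟨M, hM⟩ := exists_isCongrModOmega_quadraticBranch_odd hp2 hf0 hQ hpN hap
  have h1 : IsQuadraticBranchMinusLFunction f p 1 M :=
    EtaMinusCoeffCongruence.isQuadraticBranchMinusLFunction_one_of_isCongrModOmega hp2 hf0 hQ hpN hap hM
  obtain ⟨k, hk⟩ := exists_norm_pow_mul_le_one (p := p) ϖ
  set c' : ℤ_[p] := ⟨(((p : ℚ) ^ k * ϖ : ℚ) : ℚ_[p]), hk⟩ with hc'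
  have h2 : IsQuadraticBranchMinusLFunction f p ((p : ℚ) ^ k * ϖ) (PowerSeries.C c' * M) := by
    have h := EtaMinusCoeffCongruence.isQuadraticBranchMinusLFunction_C_mul h1 c' ((p : ℚ) ^ k * ϖ) rfl
    rwa [mul_one] at h
  have h3 : IsQuadraticBranchMinusLFunction f p ((p : ℚ) ^ k * ϖ) (PowerSeries.C ((p : ℤ_[p]) ^ k) * L) :=
    EtaMinusCoeffCongruence.isQuadraticBranchMinusLFunction_C_mul hL ((p : ℤ_[p]) ^ k) ((p : ℚ) ^ k) (by push_cast; rfl)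
  obtain ⟨v, hv⟩ := IsQuadraticBranchMinusLFunction.exists_units_smul_eq hp2 h2 h3
  rw [PowerSeries.smul_eq_C_mul] at hv
  have hFE := invol_mazurTateMinus_eq hp2 hf0 hQ hpN hap hσ hW hc ha hM
  have hpk : PowerSeries.C ((p : ℤ_[p]) ^ k) ≠ 0 := fun h ↦ pow_ne_zero k (Nat.cast_ne_zero.mpr hP.ne_zero : (p : ℤ_[p]) ≠ 0)
    (by simpa only [PowerSeries.constantCoeff_C, map_zero] using congr_arg PowerSeries.constantCoeff h)
  refine mul_left_cancel₀ hpk ?_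
  have e1 : PowerSeries.C ((p : ℤ_[p]) ^ k) * invol p L = invol p (PowerSeries.C ((p : ℤ_[p]) ^ k) * L) := by
    rw [map_mul (invol p), invol_C]
  rw [e1, hv, map_mul (invol p), map_mul (invol p), invol_C, invol_C, hFE]
  linear_combination (-(PowerSeries.C ((σ * legendreSym p (-(N : ℤ)) : ℤ) : ℤ_[p]) *
    PowerSeries.binomialSeries ℤ_[p] (c + a))) * hv

/-! ### Packaged forms: existence of the exponent, the shape of `Sprung2017.cor414_…` (any `ι` with `(1+T)(ι+1) = 1`), ideal form -/

/-- **Existence form (plus)**: for every plus branch function `L` there is a `p`-adic exponent `e` with `ι L = w·(1+T)^e·L`,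
`w = σ·(−N | p)` (`e = c + b` from `exists_teichmuller_exponent_natCast` and `(p+1)b = −1`).
[cite: Sprung2017, Cor. 4.14 (a_p = 0 display)] [cite: MazurTateTeitelbaum1986Invent, §I.17] -/
theorem exists_invol_eq_of_isQuadraticBranchPlusLFunction (hp2 : p ≠ 2) (hf0 : IsNewform0 f) (hQ : coeffField f = ⊥)
    (hpN : ¬ p ∣ N) (hap : cuspCoeff f p = ((0 : ℤ) : ℂ)) {σ : ℤ} (hσ : σ ^ 2 = 1)
    (hW : atkinLehnerInvolution N 2 N f = (-(σ : ℂ)) • f)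
    {ϖ : ℚ} {L : IwasawaAlgebra p} (hL : IsQuadraticBranchPlusLFunction f p ϖ L) :
    ∃ e : ℤ_[p], invol p L = PowerSeries.C ((σ * legendreSym p (-(N : ℤ)) : ℤ) : ℤ_[p]) *
      PowerSeries.binomialSeries ℤ_[p] e * L := by
  obtain ⟨ηN, c, hc⟩ := exists_teichmuller_exponent_natCast p hpN
  obtain ⟨b, hb⟩ := exists_natCast_add_one_mul_eq (p := p) (-1)
  exact ⟨c + b, invol_eq_of_isQuadraticBranchPlusLFunction hp2 hf0 hQ hpN hap hσ hW hc hb hL⟩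

/-- **Existence form (minus)**: `ι L = w·(1+T)^e·L` for some `e ∈ ℤ_p`, every minus branch function.
[cite: Sprung2017, Cor. 4.14 (a_p = 0 display)] [cite: MazurTateTeitelbaum1986Invent, §I.17] -/
theorem exists_invol_eq_of_isQuadraticBranchMinusLFunction (hp2 : p ≠ 2) (hf0 : IsNewform0 f) (hQ : coeffField f = ⊥)
    (hpN : ¬ p ∣ N) (hap : cuspCoeff f p = ((0 : ℤ) : ℂ)) {σ : ℤ} (hσ : σ ^ 2 = 1)
    (hW : atkinLehnerInvolution N 2 N f = (-(σ : ℂ)) • f)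
    {ϖ : ℚ} {L : IwasawaAlgebra p} (hL : IsQuadraticBranchMinusLFunction f p ϖ L) :
    ∃ e : ℤ_[p], invol p L = PowerSeries.C ((σ * legendreSym p (-(N : ℤ)) : ℤ) : ℤ_[p]) *
      PowerSeries.binomialSeries ℤ_[p] e * L := by
  obtain ⟨ηN, c, hc⟩ := exists_teichmuller_exponent_natCast p hpN
  obtain ⟨a, ha⟩ := exists_natCast_add_one_mul_eq (p := p) (-(p : ℤ_[p]))
  exact ⟨c + a, invol_eq_of_isQuadraticBranchMinusLFunction hp2 hf0 hQ hpN hap hσ hW hc ha hL⟩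

omit hp in
/-- There is exactly one `ι ∈ Λ` with `(1+T)(ι+1) = 1`, namely `(1+T)⁻¹ − 1 = invSubOne p` (the binder of `Sprung2017.cor414_…`). [folklore] -/
theorem eq_invSubOne_of_one_add_X_mul_eq_one [Fact p.Prime] {ι : IwasawaAlgebra p}
    (hι : (1 + PowerSeries.X : IwasawaAlgebra p) * (ι + 1) = 1) : ι = invSubOne p := by
  have h2 : (1 + PowerSeries.X : IwasawaAlgebra p) * (invSubOne p + 1) = 1 := by
    rw [add_comm (invSubOne p) 1]; exact one_add_X_mul_one_add_invSubOne p
  have hu : IsUnit (1 + PowerSeries.X : IwasawaAlgebra p) := by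
    rw [PowerSeries.isUnit_iff_constantCoeff, map_add, map_one, PowerSeries.constantCoeff_X, add_zero]
    exact isUnit_one
  exact add_right_cancel (hu.mul_left_cancel (hι.trans h2.symm))

/-- **The plus equation in the SHAPE OF THE TREE'S NAMED FACT `Sprung2017.cor414_sharpFlat_functionalEquation_apZero`** (there: the
trivial branch, `L♭`, exponent `c + b`): for every `ι ∈ Λ` with `(1+T)(ι+1) = 1` and every plus branch function `L` on the quadratic branch,
`L(ι) = (σ·(−N|p)) · (1+T)^{c+b} · L`. [cite: Sprung2017, Cor. 4.14 (a_p = 0 display, ωⁱ(−N) sign)] [cite: MazurTateTeitelbaum1986Invent, §I.17] -/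
theorem subst_eq_of_isQuadraticBranchPlusLFunction (hp2 : p ≠ 2) (hf0 : IsNewform0 f) (hQ : coeffField f = ⊥)
    (hpN : ¬ p ∣ N) (hap : cuspCoeff f p = ((0 : ℤ) : ℂ)) {σ : ℤ} (hσ : σ ^ 2 = 1)
    (hW : atkinLehnerInvolution N 2 N f = (-(σ : ℂ)) • f)
    {ηN : rootsOfUnity (torsionOrder p) ℤ_[p]} {c : ℤ_[p]}
    (hc : ∀ n : ℕ, PadicInt.toZModPow (n + cyclotomicExponent p) ((ηN : ℤ_[p]ˣ) : ℤ_[p]) *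
      (cyclotomicGenerator p : ZMod (p ^ (n + cyclotomicExponent p))) ^ (PadicInt.toZModPow n c).val =
        (N : ZMod (p ^ (n + cyclotomicExponent p))))
    {b : ℤ_[p]} (hb : ((p : ℤ_[p]) + 1) * b = -1)
    {ι : IwasawaAlgebra p} (hι : (1 + PowerSeries.X : IwasawaAlgebra p) * (ι + 1) = 1)
    {ϖ : ℚ} {L : IwasawaAlgebra p} (hL : IsQuadraticBranchPlusLFunction f p ϖ L) :
    L.subst ι = ((σ * legendreSym p (-(N : ℤ)) : ℤ) : IwasawaAlgebra p) *
      PowerSeries.binomialSeries ℤ_[p] (c + b) * L := by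
  rw [eq_invSubOne_of_one_add_X_mul_eq_one hι, ← invol_apply,
    invol_eq_of_isQuadraticBranchPlusLFunction hp2 hf0 hQ hpN hap hσ hW hc hb hL, map_intCast]

/-- **The minus equation in the shape of `Sprung2017.cor414_…`** (there: `L♯`, exponent `c + a`): `L(ι) = (σ·(−N|p)) · (1+T)^{c+a} · L`.
[cite: Sprung2017, Cor. 4.14 (a_p = 0 display, ωⁱ(−N) sign)] [cite: MazurTateTeitelbaum1986Invent, §I.17] -/
theorem subst_eq_of_isQuadraticBranchMinusLFunction (hp2 : p ≠ 2) (hf0 : IsNewform0 f) (hQ : coeffField f = ⊥)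
    (hpN : ¬ p ∣ N) (hap : cuspCoeff f p = ((0 : ℤ) : ℂ)) {σ : ℤ} (hσ : σ ^ 2 = 1)
    (hW : atkinLehnerInvolution N 2 N f = (-(σ : ℂ)) • f)
    {ηN : rootsOfUnity (torsionOrder p) ℤ_[p]} {c : ℤ_[p]}
    (hc : ∀ n : ℕ, PadicInt.toZModPow (n + cyclotomicExponent p) ((ηN : ℤ_[p]ˣ) : ℤ_[p]) *
      (cyclotomicGenerator p : ZMod (p ^ (n + cyclotomicExponent p))) ^ (PadicInt.toZModPow n c).val =
        (N : ZMod (p ^ (n + cyclotomicExponent p))))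
    {a : ℤ_[p]} (ha : ((p : ℤ_[p]) + 1) * a = -(p : ℤ_[p]))
    {ι : IwasawaAlgebra p} (hι : (1 + PowerSeries.X : IwasawaAlgebra p) * (ι + 1) = 1)
    {ϖ : ℚ} {L : IwasawaAlgebra p} (hL : IsQuadraticBranchMinusLFunction f p ϖ L) :
    L.subst ι = ((σ * legendreSym p (-(N : ℤ)) : ℤ) : IwasawaAlgebra p) *
      PowerSeries.binomialSeries ℤ_[p] (c + a) * L := by
  rw [eq_invSubOne_of_one_add_X_mul_eq_one hι, ← invol_apply,
    invol_eq_of_isQuadraticBranchMinusLFunction hp2 hf0 hQ hpN hap hσ hW hc ha hL, map_intCast]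

/-- **IDEAL FORM (plus): `(ι L) = (L)` as ideals of `Λ`** for every plus branch function `L = L_p⁺(V, η, X)` — the sign and the multiplier
`(1+T)^{c+b}` are units (Greenberg: "`f(T^ι)/f(T)` should be in `Λ^×`"). No Fricke sign, exponent or period hypothesis in the statement: the
principal ideal `(L_p⁺(V,η,X))` — the analytic side of the η-main conjecture of the crux — is `ι`-stable, i.e. insensitive to the
`γ ↦ γ⁻¹` convention on the Selmer side. [cite: GreenbergLNM1716, §1 (pp. 67–68) and Thm. 1.14] [cite: MazurTateTeitelbaum1986Invent, §I.17] -/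
theorem span_invol_eq_of_isQuadraticBranchPlusLFunction (hp2 : p ≠ 2) (hf0 : IsNewform0 f) (hQ : coeffField f = ⊥)
    (hpN : ¬ p ∣ N) (hap : cuspCoeff f p = ((0 : ℤ) : ℂ))
    {ϖ : ℚ} {L : IwasawaAlgebra p} (hL : IsQuadraticBranchPlusLFunction f p ϖ L) :
    Ideal.span {invol p L} = Ideal.span {L} := by
  obtain ⟨σ, hσ, hW⟩ := exists_frickeSign_of_isNewform0 hf0
  obtain ⟨e, he⟩ := exists_invol_eq_of_isQuadraticBranchPlusLFunction hp2 hf0 hQ hpN hap hσ hW hL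
  rw [he]
  exact Ideal.span_singleton_mul_left_unit (isUnit_C_sign_mul_binomialSeries (sign_eq_one_or hpN hσ) e) L

/-- **IDEAL FORM (minus): `(ι L) = (L)`** for every minus branch function `L = L_p⁻(V, η, X)`.
[cite: GreenbergLNM1716, §1 (pp. 67–68) and Thm. 1.14] [cite: MazurTateTeitelbaum1986Invent, §I.17] -/
theorem span_invol_eq_of_isQuadraticBranchMinusLFunction (hp2 : p ≠ 2) (hf0 : IsNewform0 f) (hQ : coeffField f = ⊥)
    (hpN : ¬ p ∣ N) (hap : cuspCoeff f p = ((0 : ℤ) : ℂ))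
    {ϖ : ℚ} {L : IwasawaAlgebra p} (hL : IsQuadraticBranchMinusLFunction f p ϖ L) :
    Ideal.span {invol p L} = Ideal.span {L} := by
  obtain ⟨σ, hσ, hW⟩ := exists_frickeSign_of_isNewform0 hf0
  obtain ⟨e, he⟩ := exists_invol_eq_of_isQuadraticBranchMinusLFunction hp2 hf0 hQ hpN hap hσ hW hL
  rw [he]
  exact Ideal.span_singleton_mul_left_unit (isUnit_C_sign_mul_binomialSeries (sign_eq_one_or hpN hσ) e) L

/-- `ι L` and `L` are associated in `Λ` (plus branch function). [cite: GreenbergLNM1716, §1 (p. 68)] -/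
theorem associated_invol_of_isQuadraticBranchPlusLFunction (hp2 : p ≠ 2) (hf0 : IsNewform0 f) (hQ : coeffField f = ⊥)
    (hpN : ¬ p ∣ N) (hap : cuspCoeff f p = ((0 : ℤ) : ℂ))
    {ϖ : ℚ} {L : IwasawaAlgebra p} (hL : IsQuadraticBranchPlusLFunction f p ϖ L) :
    Associated (invol p L) L := by
  obtain ⟨σ, hσ, hW⟩ := exists_frickeSign_of_isNewform0 hf0
  obtain ⟨e, he⟩ := exists_invol_eq_of_isQuadraticBranchPlusLFunction hp2 hf0 hQ hpN hap hσ hW hL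
  rw [he]
  exact associated_unit_mul_left L _ (isUnit_C_sign_mul_binomialSeries (sign_eq_one_or hpN hσ) e)

/-- `ι L` and `L` are associated in `Λ` (minus branch function). [cite: GreenbergLNM1716, §1 (p. 68)] -/
theorem associated_invol_of_isQuadraticBranchMinusLFunction (hp2 : p ≠ 2) (hf0 : IsNewform0 f) (hQ : coeffField f = ⊥)
    (hpN : ¬ p ∣ N) (hap : cuspCoeff f p = ((0 : ℤ) : ℂ))
    {ϖ : ℚ} {L : IwasawaAlgebra p} (hL : IsQuadraticBranchMinusLFunction f p ϖ L) :
    Associated (invol p L) L := by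
  obtain ⟨σ, hσ, hW⟩ := exists_frickeSign_of_isNewform0 hf0
  obtain ⟨e, he⟩ := exists_invol_eq_of_isQuadraticBranchMinusLFunction hp2 hf0 hQ hpN hap hσ hW hL
  rw [he]
  exact associated_unit_mul_left L _ (isUnit_C_sign_mul_binomialSeries (sign_eq_one_or hpN hσ) e)

end Exact

/-! ## §23 Row currency (the crux's rows `V`: good at `p ≥ 5`, `a_p(V) = 0`; NO period / Manin hypothesis) and the conductor level -/

section Row

variable {N : ℕ} [NeZero N] {f : CuspForm (Gamma0 N) 2}

/-- **THE EXACT FUNCTIONAL EQUATION AT A ROW (plus).** `V` globally minimal, good at `p ≥ 5` with `a_p(V) = 0` (every row of crux 19606,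
CM or not, onto or not), `f` its newform (any level `N`; `p ∤ N` automatic) with Fricke sign `σ`, `c` the `p`-adic exponent of `N`,
`(p+1)b = −1`; then for EVERY period ratio `ϖ` and every plus branch function `Lη = L_p⁺(V, η, X)`:
`ι Lη = σ·(−N|p) · (1+T)^{c+b} · Lη`. No named fact is used. [cite: Sprung2017, Cor. 4.14 (a_p = 0 display)]
[cite: MazurTateTeitelbaum1986Invent, §I.17] [cite: Kobayashi2003, Thm. 3.2, (3.4)] -/
theorem invol_eq_plus_row (hp5 : 5 ≤ p) (V : WeierstrassCurve ℚ) [V.IsElliptic] [V.IsGloballyMinimal]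
    (hgood : V.HasGoodReductionAtPrime p) (hap : V.frobeniusTrace p = 0) (hf : IsNewformOf V f) {σ : ℤ} (hσ : σ ^ 2 = 1)
    (hW : atkinLehnerInvolution N 2 N f = (-(σ : ℂ)) • f)
    {ηN : rootsOfUnity (torsionOrder p) ℤ_[p]} {c : ℤ_[p]}
    (hc : ∀ n : ℕ, PadicInt.toZModPow (n + cyclotomicExponent p) ((ηN : ℤ_[p]ˣ) : ℤ_[p]) *
      (cyclotomicGenerator p : ZMod (p ^ (n + cyclotomicExponent p))) ^ (PadicInt.toZModPow n c).val =
        (N : ZMod (p ^ (n + cyclotomicExponent p))))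
    {b : ℤ_[p]} (hb : ((p : ℤ_[p]) + 1) * b = -1)
    (ϖ : ℚ) {Lη : IwasawaAlgebra p} (hL : IsQuadraticBranchPlusLFunction f p ϖ Lη) :
    invol p Lη = PowerSeries.C ((σ * legendreSym p (-(N : ℤ)) : ℤ) : ℤ_[p]) *
      PowerSeries.binomialSeries ℤ_[p] (c + b) * Lη := by
  have hp2 : p ≠ 2 := by omega
  have hap' : cuspCoeff f p = ((0 : ℤ) : ℂ) := by
    rw [cuspCoeff_eq_frobeniusTrace_of_isNewformOf_holds hf hgood, hap]
  exact invol_eq_of_isQuadraticBranchPlusLFunction hp2 hf.1 hf.coeffField_eq_bot (not_dvd_level_of_isNewformOf hf hgood)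
    hap' hσ hW hc hb hL

/-- **THE EXACT FUNCTIONAL EQUATION AT A ROW (minus)**: `ι Lη = σ·(−N|p) · (1+T)^{c+a} · Lη`, `(p+1)a = −p`, every `L_p⁻(V, η, X)`.
[cite: Sprung2017, Cor. 4.14 (a_p = 0 display)] [cite: MazurTateTeitelbaum1986Invent, §I.17] [cite: Kobayashi2003, Thm. 3.2, (3.5)] -/
theorem invol_eq_minus_row (hp5 : 5 ≤ p) (V : WeierstrassCurve ℚ) [V.IsElliptic] [V.IsGloballyMinimal]
    (hgood : V.HasGoodReductionAtPrime p) (hap : V.frobeniusTrace p = 0) (hf : IsNewformOf V f) {σ : ℤ} (hσ : σ ^ 2 = 1)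
    (hW : atkinLehnerInvolution N 2 N f = (-(σ : ℂ)) • f)
    {ηN : rootsOfUnity (torsionOrder p) ℤ_[p]} {c : ℤ_[p]}
    (hc : ∀ n : ℕ, PadicInt.toZModPow (n + cyclotomicExponent p) ((ηN : ℤ_[p]ˣ) : ℤ_[p]) *
      (cyclotomicGenerator p : ZMod (p ^ (n + cyclotomicExponent p))) ^ (PadicInt.toZModPow n c).val =
        (N : ZMod (p ^ (n + cyclotomicExponent p))))
    {a : ℤ_[p]} (ha : ((p : ℤ_[p]) + 1) * a = -(p : ℤ_[p]))
    (ϖ : ℚ) {Lη : IwasawaAlgebra p} (hL : IsQuadraticBranchMinusLFunction f p ϖ Lη) :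
    invol p Lη = PowerSeries.C ((σ * legendreSym p (-(N : ℤ)) : ℤ) : ℤ_[p]) *
      PowerSeries.binomialSeries ℤ_[p] (c + a) * Lη := by
  have hp2 : p ≠ 2 := by omega
  have hap' : cuspCoeff f p = ((0 : ℤ) : ℂ) := by
    rw [cuspCoeff_eq_frobeniusTrace_of_isNewformOf_holds hf hgood, hap]
  exact invol_eq_of_isQuadraticBranchMinusLFunction hp2 hf.1 hf.coeffField_eq_bot (not_dvd_level_of_isNewformOf hf hgood)
    hap' hσ hW hc ha hL

/-- **`(ι Lη) = (Lη)` AT A ROW (plus)**: for the newform of a row `V` (good at `p ≥ 5`, `a_p(V) = 0`), any period ratio and every plus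
branch function, the principal ideal `(L_p⁺(V, η, X)) ⊂ Λ` is `ι`-stable. Hypothesis-free beyond the row data.
[cite: GreenbergLNM1716, §1 (pp. 67–68) and Thm. 1.14] [cite: MazurTateTeitelbaum1986Invent, §I.17] -/
theorem span_invol_eq_plus_row (hp5 : 5 ≤ p) (V : WeierstrassCurve ℚ) [V.IsElliptic] [V.IsGloballyMinimal]
    (hgood : V.HasGoodReductionAtPrime p) (hap : V.frobeniusTrace p = 0) (hf : IsNewformOf V f)
    (ϖ : ℚ) {Lη : IwasawaAlgebra p} (hL : IsQuadraticBranchPlusLFunction f p ϖ Lη) :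
    Ideal.span {invol p Lη} = Ideal.span {Lη} := by
  have hp2 : p ≠ 2 := by omega
  have hap' : cuspCoeff f p = ((0 : ℤ) : ℂ) := by
    rw [cuspCoeff_eq_frobeniusTrace_of_isNewformOf_holds hf hgood, hap]
  exact span_invol_eq_of_isQuadraticBranchPlusLFunction hp2 hf.1 hf.coeffField_eq_bot (not_dvd_level_of_isNewformOf hf hgood)
    hap' hL

/-- **`(ι Lη) = (Lη)` AT A ROW (minus)**. [cite: GreenbergLNM1716, §1 (pp. 67–68) and Thm. 1.14] [cite: MazurTateTeitelbaum1986Invent, §I.17] -/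
theorem span_invol_eq_minus_row (hp5 : 5 ≤ p) (V : WeierstrassCurve ℚ) [V.IsElliptic] [V.IsGloballyMinimal]
    (hgood : V.HasGoodReductionAtPrime p) (hap : V.frobeniusTrace p = 0) (hf : IsNewformOf V f)
    (ϖ : ℚ) {Lη : IwasawaAlgebra p} (hL : IsQuadraticBranchMinusLFunction f p ϖ Lη) :
    Ideal.span {invol p Lη} = Ideal.span {Lη} := by
  have hp2 : p ≠ 2 := by omega
  have hap' : cuspCoeff f p = ((0 : ℤ) : ℂ) := by
    rw [cuspCoeff_eq_frobeniusTrace_of_isNewformOf_holds hf hgood, hap]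
  exact span_invol_eq_of_isQuadraticBranchMinusLFunction hp2 hf.1 hf.coeffField_eq_bot (not_dvd_level_of_isNewformOf hf hgood)
    hap' hL

end Row

section Root

variable {V : WeierstrassCurve ℚ} [V.IsElliptic] [NeZero (V.conductorNorm ℤ)]
  {f : CuspForm (Gamma0 (V.conductorNorm ℤ)) 2} [V.IsGloballyMinimal]

/-- **CONDUCTOR LEVEL (plus): `ι Lη = w_V·(−N_V | p) · (1+T)^{c+b} · Lη`** — for the newform of `V` AT LEVEL `N_V` the Fricke sign is the
root number (`atkinLehnerInvolution_eq_neg_rootNumber_smul`, Part VII), so the sign of the exact functional equation of `L_p⁺(V, η, X)` is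
`w_V · η(−N_V) = w(V ⊗ η)`, the root number of the additive partner `W = V^{(p*)}`; `c` is the `p`-adic exponent of `N_V`, `(p+1)b = −1`.
[cite: Sprung2017, Cor. 4.14 (a_p = 0 display)] [cite: MazurTateTeitelbaum1986Invent, §I.17] [cite: AtkinLehner1970, Thm. 3] -/
theorem invol_eq_plus_rootNumber (hp5 : 5 ≤ p) (hgood : V.HasGoodReductionAtPrime p) (hap : V.frobeniusTrace p = 0)
    (hf : IsNewformOf V f) {ηN : rootsOfUnity (torsionOrder p) ℤ_[p]} {c : ℤ_[p]}
    (hc : ∀ n : ℕ, PadicInt.toZModPow (n + cyclotomicExponent p) ((ηN : ℤ_[p]ˣ) : ℤ_[p]) *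
      (cyclotomicGenerator p : ZMod (p ^ (n + cyclotomicExponent p))) ^ (PadicInt.toZModPow n c).val =
        (V.conductorNorm ℤ : ZMod (p ^ (n + cyclotomicExponent p))))
    {b : ℤ_[p]} (hb : ((p : ℤ_[p]) + 1) * b = -1)
    (ϖ : ℚ) {Lη : IwasawaAlgebra p} (hL : IsQuadraticBranchPlusLFunction f p ϖ Lη) :
    invol p Lη = PowerSeries.C ((V.rootNumber * legendreSym p (-(V.conductorNorm ℤ : ℤ)) : ℤ) : ℤ_[p]) *
      PowerSeries.binomialSeries ℤ_[p] (c + b) * Lη :=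
  invol_eq_plus_row hp5 V hgood hap hf rootNumber_sq_eq_one (atkinLehnerInvolution_eq_neg_rootNumber_smul hf) hc hb ϖ hL

/-- **CONDUCTOR LEVEL (minus): `ι Lη = w_V·(−N_V | p) · (1+T)^{c+a} · Lη`**, `(p+1)a = −p`.
[cite: Sprung2017, Cor. 4.14 (a_p = 0 display)] [cite: MazurTateTeitelbaum1986Invent, §I.17] [cite: AtkinLehner1970, Thm. 3] -/
theorem invol_eq_minus_rootNumber (hp5 : 5 ≤ p) (hgood : V.HasGoodReductionAtPrime p) (hap : V.frobeniusTrace p = 0)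
    (hf : IsNewformOf V f) {ηN : rootsOfUnity (torsionOrder p) ℤ_[p]} {c : ℤ_[p]}
    (hc : ∀ n : ℕ, PadicInt.toZModPow (n + cyclotomicExponent p) ((ηN : ℤ_[p]ˣ) : ℤ_[p]) *
      (cyclotomicGenerator p : ZMod (p ^ (n + cyclotomicExponent p))) ^ (PadicInt.toZModPow n c).val =
        (V.conductorNorm ℤ : ZMod (p ^ (n + cyclotomicExponent p))))
    {a : ℤ_[p]} (ha : ((p : ℤ_[p]) + 1) * a = -(p : ℤ_[p]))
    (ϖ : ℚ) {Lη : IwasawaAlgebra p} (hL : IsQuadraticBranchMinusLFunction f p ϖ Lη) :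
    invol p Lη = PowerSeries.C ((V.rootNumber * legendreSym p (-(V.conductorNorm ℤ : ℤ)) : ℤ) : ℤ_[p]) *
      PowerSeries.binomialSeries ℤ_[p] (c + a) * Lη :=
  invol_eq_minus_row hp5 V hgood hap hf rootNumber_sq_eq_one (atkinLehnerInvolution_eq_neg_rootNumber_smul hf) hc ha ϖ hL

end Root

end Summit.BirchSwinnertonDyer.BirchSwinnertonDyer.Theorems.EtaThetaFunctionalEquation

end
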